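/-
Copyright (c) 2026 the pub-hodgecm-mathlib formalisation cell (harness21).  Prover seat hodgecm-mathlib-K2E3-p17 (g8), HCML Track B «K2-LIT» ∕ h413
(`stmt-HodgeConjecture-24833`), line `K2_E3_EllipticInputs`, unit U12 «Characters», road «GL₂-sc» NE half (NE lead K2E3-p23 (g6), road owner K2E5-p17 (g5),
dealer K2E3-plan (g4)), brick (2N-5) part 3, file 2: the `hball` hypothesis packaged Haar-a.e. on `G' = GL₂(F) ⧸ ϖ^ℤ` with the CORRECT `N = 2` normalisation
`δ = ‖disc χ‖ ∕ ‖det‖` (NE lead ERRATUM 2026-09-04 09:41:11Z) — the `N = 2` twin of ★ `K2E3GL3ModUniformizerNonEllBall` §4 (K2E3-p23 (g5)).  2026-09-04.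
-/
import Summits.HodgeConjecture.HodgeConjecture.Theorems.K2E3GL2ModUniformizerNonEllBall       -- ★ (2N-5) part 3 file 1 p859085 (this seat): §1 `coe_scalar_mul`, `smul_conj`, `exists_glDiagonal_conj_eq`, `charpoly_discr_of_conj_diagonal`, `adBall_of_integral_of_inv`, `v_pow_pow_two_le_v_det`; brings part 2 (split mouth), ★ 2N-0d, ★ N = 3 generic §2∕§3
import HarnessLib

/-!
# Road «GL₂-sc» NE half, brick (2N-5) part 3 (file 2): `hball` PACKAGED — Haar-a.e. on `G' = GL₂(F) ⧸ ϖ^ℤ`, off the elliptic set,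
# `∫_{Ω (R x̄)} ‖θ(z · x̄ · z⁻¹)‖ dμ'(z) ≤ M_θ · (c · C(m) · 2(2(R x̄ + 4 h(x̄) + L(x̄))+1) · q^{h(x̄)} · |D♮(x̄)|^{-1∕2})`, `D♮ = disc χ ∕ det` (Harish-Chandra 1970, VII §3)

Cell `pub/hodgecm-mathlib` (D-0151), Track B «K2-LIT», crux H413 = `stmt-HodgeConjecture-24833`, route of record `HCCMUnconditional`.  Lane
`--supports stmt-HodgeConjecture-24833 --as helper`; THEOREMS ONLY (no `def`, no `instance`, no `notation`, no named-fact hypothesis, no `sorry`); count-neutral.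

WHY A SECOND FILE.  File 1 (★ p859085) typed the a.e. package against the `N = 3` letter `δ(mk g) = ‖disc χ_g‖ ∕ ‖det g‖²`; at `N = 2` `disc χ` is homogeneous of degree
`n(n−1) = 2 = deg det` (`disc χ_{wg} = w² disc χ_g`, `det(wg) = w² det g`), so the scale-invariant normalisation is `‖disc χ_g‖ ∕ ‖det g‖` (FIRST power) and the `det²`
letter admits NO `δ` on the quotient — that head is vacuous and superseded here (append-only tree: it stays, unused).  This is the same normalisation as ★ 2N-1's depth
letter `v(ϖ^L·(d 0 * d 1)) ≤ v((d 0 − d 1)^2)` (`D♮ = (d₀−d₁)²∕(d₀d₁)`) and as ★ 2N-7 F1 `K2E3GL2ModUniformizerNonEllCoordinates.exists_coordinates` (K2E3-p23 (g6)).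

This is the `hball` input of the non-elliptic estimates (2N-7, `hNE₂`) in the road's currency, for ANY radius `R : G' → ℕ`, with the weight written in three user-supplied
coordinates of `x̄ ∈ G'` (all quantified, no `def`): a height `h : G' → ℕ` with `x̄ ∈ Ω (h x̄)`, the normalised discriminant `δ : G' → ℝ≥0`,
`δ(mk g) = ‖disc χ_g‖ ∕ ‖det g‖`, and a depth `L : G' → ℕ` with `q^{-L x̄} ≤ δ x̄` wherever `δ x̄ ≠ 0`.
Proof at a.e. `x̄` with NON-compact centraliser: ★ 2N-0d gives a lift `g = y · diag d · y⁻¹`, `d` injective; ★ B4-0 `exists_zpow_scalar_mul_integral_of_adBall` rescales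
`g` to an INTEGRAL representative `g₁ = ϖ^k g` of the same class (★ `mk_scalar_zpow_mul`) with `ϖ^{h} g₁⁻¹` integral; the split normal form rescales (★ file 1 §1);
the eigenvalues `t₀ ≠ t₁` of `g₁` are integral (★ `v_eigenvalue_le_one_of_conj`), `disc χ_{g₁} = (t₀ − t₁)²`, `|disc χ_{g₁}| = q^{-L₀} ≤ 1`; the split mouth
★ (2N-5) part 2 `exists_setIntegral_norm_conj_le_split` (with `s := h`, `L := L₀`) bounds the ball integral by `M_θ·(c·C(m)·2(2(R+2h+L₀)+1)·|t₀ − t₁|⁻¹)`; finally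
`‖disc χ_{g₁}‖ = δ(x̄)·‖det g₁‖`, `‖det g₁‖ ≥ q^{-2h}` (★ `v_pow_pow_two_le_v_det`) give, with `a := √‖det g₁‖ ≥ q^{-h}` in ★ generic §3 of the N = 3 file,
`|t₀ − t₁|⁻¹ = ‖disc χ_{g₁}‖^{-1∕2} ≤ q^{h}·δ(x̄)^{-1∕2}` and `L₀ ≤ L(x̄) + 2h`.
* **`ae_setIntegral_norm_conj_le_weight_sharp`** — the natural `N = 2` shape `2(2(R + (4h + L))+1) · q^{h} δ^{-1∕2}`, no hypothesis on `2`;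
* **`ae_setIntegral_norm_conj_le_weight`** — the SAME bound weakened into the `N = 3` letter shape `3(2(R + (12h + L))+1)² · ‖2‖⁻¹ q^{m+1} · q^{3h} δ^{-1∕2}` of
  ★ `K2E3GL3ModUniformizerNonEllBall.ae_setIntegral_norm_conj_le_weight` :215 (binders verbatim with `Fin 3 ↦ Fin 2` and `det` to the first power, incl.
  `(h2 : (2 : F) ≠ 0)` — used for `‖2‖⁻¹ ≥ 1`), so that (2N-7)'s assembly is ★ `K2E3GL3ModUniformizerNonEllEstimatesOfMixed` token for token (NE lead's PINNED HEADS
  2026-09-04 09:40:44Z).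
HONEST LABEL: HC_CM is proved only modulo the 7 printed citations (2 remaining named inputs: hLiu418 = stmt-HodgeConjecture-24832, h413 = stmt-HodgeConjecture-24833) until
rung 0 closes; count-neutral helper, closes no socket.

## References
* [HarishChandra1970] Harish-Chandra (notes by G. van Dijk), *Harmonic Analysis on Reductive p-adic Groups*, LNM 162 (1970), Part VII §2 Theorem 18 p. 69, §3 pp. 72–73.
* [JacquetLanglands1970] H. Jacquet, R. P. Langlands, *Automorphic Forms on GL(2)*, LNM 114 (1970), §7 (local integrability of supercuspidal characters of `GL₂`).
-/

set_option autoImplicit false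
-- the mandated namespace repeats the single-problem summit's segment (`HodgeConjecture.HodgeConjecture`)
set_option linter.dupNamespace false

noncomputable section

open MeasureTheory Measure Set
open scoped MatrixGroups NNReal ENNReal WithZero
open Literature.NumberTheory.Automorphic Literature.NumberTheory.GaloisRepresentations Literature.NumberTheory.GaloisRepresentations.IsNonarchimedeanLocalField
open Summit.HodgeConjecture.HodgeConjecture.Cruxes.H413.K2E3GLnAdHeightBalls Summit.HodgeConjecture.HodgeConjecture.Cruxes.H413.K2E3GL2ModUniformizerFundamentalDomain
open Summit.HodgeConjecture.HodgeConjecture.Cruxes.H413.K2E3GL2ModUniformizerBallBoundSplit Summit.HodgeConjecture.HodgeConjecture.Cruxes.H413.K2E3GL2ModUniformizerSeparableAE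
open Summit.HodgeConjecture.HodgeConjecture.Cruxes.H413.K2E3GL2ModUniformizerNonEllBall
open Summit.HodgeConjecture.HodgeConjecture.Cruxes.H413.K2E3GL3TruncatedCharSplitTorusRadius (v_eigenvalue_le_one_of_conj)
open Summit.HodgeConjecture.HodgeConjecture.Cruxes.H413.K2E3GL3ModUniformizerNonEllBallMixed (le_toReal_bound_mono normAbs_uniformizer_eq_inv)
open Summit.HodgeConjecture.HodgeConjecture.Cruxes.H413.K2E3GL3ModUniformizerNonEllBall (v_sub_le_one exists_nat_v_eq_exp_neg inv_sqrt_le_of_eq_mul_sq le_add_of_pow_eq_of_pow_mul_pow_le)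
open Summit.HodgeConjecture.HodgeConjecture.Cruxes.H413.K2E3GL2EllipticConjugacyCount (normAbs_natCast_le_one)

namespace Summit.HodgeConjecture.HodgeConjecture.Cruxes.H413.K2E3GL2ModUniformizerNonEllBallWeight

variable {F : Type*} [Field F] [Valued F ℤᵐ⁰] [ValuativeRel F] [(Valued.v : Valuation F ℤᵐ⁰).Compatible] [IsNonarchimedeanLocalField F]
  [MeasurableSpace (GL (Fin 2) F)] [BorelSpace (GL (Fin 2) F)]
  {ϖ : F} (hϖ : Valued.v ϖ = WithZero.exp (-1 : ℤ)) (hϖ0 : ϖ ≠ 0)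
  [((Subgroup.zpowers (Units.mk0 ϖ hϖ0)).map (Matrix.GeneralLinearGroup.scalar (Fin 2))).Normal]
  [MeasurableSpace (GL (Fin 2) F ⧸ (Subgroup.zpowers (Units.mk0 ϖ hϖ0)).map (Matrix.GeneralLinearGroup.scalar (Fin 2)))]
  [BorelSpace (GL (Fin 2) F ⧸ (Subgroup.zpowers (Units.mk0 ϖ hϖ0)).map (Matrix.GeneralLinearGroup.scalar (Fin 2)))]
  (μ' : Measure (GL (Fin 2) F ⧸ (Subgroup.zpowers (Units.mk0 ϖ hϖ0)).map (Matrix.GeneralLinearGroup.scalar (Fin 2)))) [μ'.IsHaarMeasure]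

include hϖ in
/-- **`hball` PACKAGED, THE NATURAL `N = 2` SHAPE (Haar-a.e. on `G' = GL₂(F) ⧸ ϖ^ℤ`, off the elliptic set).**  There are `c : ℝ≥0` and `C : ℕ → ℝ≥0∞` finite such that
for every `θ : G' → E` bounded by `M_θ` and vanishing off `Ω m`, every height `h` (`x̄ ∈ Ω (h x̄)`), every `δ` with `δ(mk g) = ‖disc χ_g‖ ∕ ‖det g‖` (the scale-invariant
normalisation at `N = 2`), every depth `L` with `q^{-L x̄} ≤ δ x̄` where `δ x̄ ≠ 0`, and every radius `R : G' → ℕ`: for `μ'`-a.e. `x̄` with NON-compact centraliser,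
`∫_{Ω (R x̄)} ‖θ(z · x̄ · z⁻¹)‖ dμ'(z) ≤ M_θ · (c · (C m · 2(2(R x̄ + (4 h x̄ + L x̄))+1) · (q^{h x̄} · δ(x̄)^{-1∕2}))).toReal`.
[cite: HarishChandra1970, Part VII §2 Theorem 18 p. 69; §3 pp. 72–73] [cite: JacquetLanglands1970, §7] -/
theorem ae_setIntegral_norm_conj_le_weight_sharp {E : Type*} [NormedAddCommGroup E]
    (Ω : ℕ → Set (GL (Fin 2) F ⧸ (Subgroup.zpowers (Units.mk0 ϖ hϖ0)).map (Matrix.GeneralLinearGroup.scalar (Fin 2))))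
    (hmem : ∀ (n : ℕ) (z : GL (Fin 2) F),
      (QuotientGroup.mk z : GL (Fin 2) F ⧸ (Subgroup.zpowers (Units.mk0 ϖ hϖ0)).map (Matrix.GeneralLinearGroup.scalar (Fin 2))) ∈ Ω n ↔
        ∀ i j k l, Valued.v (ϖ ^ n * ((z : Matrix (Fin 2) (Fin 2) F) i j * ((z⁻¹ : GL (Fin 2) F) : Matrix (Fin 2) (Fin 2) F) k l)) ≤ 1) :
    ∃ (c : ℝ≥0) (C : ℕ → ℝ≥0∞), (∀ m, C m ≠ ⊤) ∧
      ∀ (θ : GL (Fin 2) F ⧸ (Subgroup.zpowers (Units.mk0 ϖ hϖ0)).map (Matrix.GeneralLinearGroup.scalar (Fin 2)) → E) (Mθ : ℝ) (m : ℕ),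
        (∀ x, ‖θ x‖ ≤ Mθ) → (∀ x, x ∉ Ω m → θ x = 0) →
        ∀ (hgt : GL (Fin 2) F ⧸ (Subgroup.zpowers (Units.mk0 ϖ hϖ0)).map (Matrix.GeneralLinearGroup.scalar (Fin 2)) → ℕ)
          (δ : GL (Fin 2) F ⧸ (Subgroup.zpowers (Units.mk0 ϖ hϖ0)).map (Matrix.GeneralLinearGroup.scalar (Fin 2)) → ℝ≥0)
          (L R : GL (Fin 2) F ⧸ (Subgroup.zpowers (Units.mk0 ϖ hϖ0)).map (Matrix.GeneralLinearGroup.scalar (Fin 2)) → ℕ),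
          (∀ x, x ∈ Ω (hgt x)) →
          (∀ g : GL (Fin 2) F, δ (QuotientGroup.mk g) =
              normAbs F ((g : Matrix (Fin 2) (Fin 2) F)).charpoly.discr / normAbs F ((g : Matrix (Fin 2) (Fin 2) F)).det) →
          (∀ x, δ x ≠ 0 → ((residueFieldCard F : ℝ≥0)⁻¹) ^ (L x) ≤ δ x) →
          ∀ᵐ x ∂μ', ¬ IsCompact ((Subgroup.centralizer {x} :
                Subgroup (GL (Fin 2) F ⧸ (Subgroup.zpowers (Units.mk0 ϖ hϖ0)).map (Matrix.GeneralLinearGroup.scalar (Fin 2)))) :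
              Set (GL (Fin 2) F ⧸ (Subgroup.zpowers (Units.mk0 ϖ hϖ0)).map (Matrix.GeneralLinearGroup.scalar (Fin 2)))) →
            ∫ z in Ω (R x), ‖θ (z * x * z⁻¹)‖ ∂μ' ≤
              Mθ * ((c : ℝ≥0∞) * (C m * ((2 * (2 * (R x + (4 * hgt x + L x)) + 1) : ℕ) : ℝ≥0∞) *
                (((residueFieldCard F : ℝ≥0) ^ (hgt x) * (NNReal.sqrt (δ x))⁻¹) : ℝ≥0))).toReal := by
  obtain ⟨c, C, hC, hmouth⟩ := exists_setIntegral_norm_conj_le_split (E := E) hϖ hϖ0 μ' Ω hmem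
  refine ⟨c, C, hC, fun θ Mθ m hM hsupp hgt δ L R hhgt hδ hL => ?_⟩
  have hMθ : 0 ≤ Mθ := (norm_nonneg _).trans (hM 1)
  filter_upwards [ae_isCompact_centralizer_or_normalForm hϖ hϖ0 μ'] with x hx hnc
  obtain ⟨g, rfl, -, y, d, hd, hg⟩ := hx.resolve_left hnc
  -- the height and the integral representative `g₁ = ϖ^k g`
  set h : ℕ := hgt (QuotientGroup.mk g) with hhdef
  have hball : ∀ i j k l, Valued.v (ϖ ^ h * ((g : Matrix (Fin 2) (Fin 2) F) i j * ((g⁻¹ : GL (Fin 2) F) : Matrix (Fin 2) (Fin 2) F) k l)) ≤ 1 :=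
    (hmem h g).1 (hhgt _)
  obtain ⟨k, hint, hinv⟩ := exists_zpow_scalar_mul_integral_of_adBall hϖ hϖ0 hball
  set g₁ : GL (Fin 2) F := Matrix.GeneralLinearGroup.scalar (Fin 2) (Units.mk0 ϖ hϖ0 ^ k) * g with hg₁def
  have hmk : (QuotientGroup.mk g₁ : GL (Fin 2) F ⧸ (Subgroup.zpowers (Units.mk0 ϖ hϖ0)).map (Matrix.GeneralLinearGroup.scalar (Fin 2))) =
      QuotientGroup.mk g := mk_scalar_zpow_mul hϖ0 k g
  have hu : ((Units.mk0 ϖ hϖ0 ^ k : Fˣ) : F) ≠ 0 := (Units.mk0 ϖ hϖ0 ^ k).ne_zero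
  -- the split normal form of `g₁`: `g₁ = y · diag(u•d) · y⁻¹`
  have hg₁ : (g₁ : Matrix (Fin 2) (Fin 2) F) =
      (y : Matrix (Fin 2) (Fin 2) F) * Matrix.diagonal (((Units.mk0 ϖ hϖ0 ^ k : Fˣ) : F) • d) * ((y⁻¹ : GL (Fin 2) F) : Matrix (Fin 2) (Fin 2) F) := by
    rw [hg₁def, coe_scalar_mul, hg, smul_conj, ← Matrix.diagonal_smul]
  have hd₁ : Function.Injective (((Units.mk0 ϖ hϖ0 ^ k : Fˣ) : F) • d) := fun i j hij =>
    hd (mul_left_cancel₀ hu (by simpa [Pi.smul_apply, smul_eq_mul] using hij))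
  obtain ⟨hd0, hg₁'⟩ := exists_glDiagonal_conj_eq hg₁
  set t : Fin 2 → Fˣ := fun i => Units.mk0 ((((Units.mk0 ϖ hϖ0 ^ k : Fˣ) : F) • d) i) (hd0 i) with ht
  have h01 : (t 0 : F) ≠ t 1 := fun h' => absurd (hd₁ h') (by decide)
  have hy : ∀ i j, Valued.v ((((y * glDiagonal 2 F t * y⁻¹ : GL (Fin 2) F)) : Matrix (Fin 2) (Fin 2) F) i j) ≤ 1 := by rw [← hg₁']; exact hint
  have ht1 : ∀ i, Valued.v (t i : F) ≤ 1 := fun i => v_eigenvalue_le_one_of_conj (coe_glDiagonal 2 F t) hy i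
  -- `disc χ_{g₁} = (t₀ − t₁)² ≠ 0`, integral; `disc χ_g ≠ 0`
  have hdisc₁ : ((g₁ : Matrix (Fin 2) (Fin 2) F)).charpoly.discr = ((t 0 : F) - t 1) ^ 2 := charpoly_discr_of_conj_diagonal hg₁
  have hdiscg : ((g : Matrix (Fin 2) (Fin 2) F)).charpoly.discr ≠ 0 := by
    rw [charpoly_discr_of_conj_diagonal hg]
    exact pow_ne_zero 2 (sub_ne_zero.2 fun h' => absurd (hd h') (by decide))
  have hdisc0 : ((g₁ : Matrix (Fin 2) (Fin 2) F)).charpoly.discr ≠ 0 := by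
    rw [hdisc₁]; exact pow_ne_zero 2 (sub_ne_zero.2 h01)
  have hdisc1 : Valued.v ((g₁ : Matrix (Fin 2) (Fin 2) F)).charpoly.discr ≤ 1 := by
    rw [hdisc₁, map_pow]; exact pow_le_one₀ zero_le (v_sub_le_one (ht1 0) (ht1 1))
  -- `δ x̄ = ‖disc χ_{g₁}‖ ∕ ‖det g₁‖`, nonzero
  have hdet0 : ((g₁ : Matrix (Fin 2) (Fin 2) F)).det ≠ 0 := ((Matrix.isUnit_iff_isUnit_det _).1 (Units.isUnit g₁)).ne_zero
  have hdetg0 : ((g : Matrix (Fin 2) (Fin 2) F)).det ≠ 0 := ((Matrix.isUnit_iff_isUnit_det _).1 (Units.isUnit g)).ne_zero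
  have hδx : δ (QuotientGroup.mk g) = normAbs F ((g₁ : Matrix (Fin 2) (Fin 2) F)).charpoly.discr / normAbs F ((g₁ : Matrix (Fin 2) (Fin 2) F)).det := by
    rw [← hmk]; exact hδ g₁
  have hδ0 : δ (QuotientGroup.mk g) ≠ 0 := by
    rw [hδ g]
    exact div_ne_zero ((_root_.map_ne_zero _).2 hdiscg) ((_root_.map_ne_zero _).2 hdetg0)
  have ha0 : normAbs F ((g₁ : Matrix (Fin 2) (Fin 2) F)).det ≠ 0 := (_root_.map_ne_zero _).2 hdet0
  have hDeq : normAbs F ((g₁ : Matrix (Fin 2) (Fin 2) F)).charpoly.discr = δ (QuotientGroup.mk g) * normAbs F ((g₁ : Matrix (Fin 2) (Fin 2) F)).det := by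
    rw [hδx, div_mul_cancel₀ _ ha0]
  -- in the currency of ★ generic §3: `‖disc χ_{g₁}‖ = δ · a²` with `a := √‖det g₁‖`
  set a : ℝ≥0 := NNReal.sqrt (normAbs F ((g₁ : Matrix (Fin 2) (Fin 2) F)).det) with hadef
  have hDeq' : normAbs F ((g₁ : Matrix (Fin 2) (Fin 2) F)).charpoly.discr = δ (QuotientGroup.mk g) * a ^ 2 := by
    rw [hadef, NNReal.sq_sqrt]; exact hDeq
  -- the depth exponent `L₀` of the representative and the depth hypothesis of T18₂
  obtain ⟨L₀, hL₀⟩ := exists_nat_v_eq_exp_neg hdisc0 hdisc1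
  have hϖL : Valued.v (ϖ ^ L₀) = WithZero.exp (-(L₀ : ℤ)) := by
    rw [map_pow, hϖ, ← WithZero.exp_nsmul]; congr 1; simp
  have hLdepth : Valued.v (ϖ ^ L₀ * ((t 0 : F) * t 1)) ≤ Valued.v (((t 0 : F) - t 1) ^ 2) := by
    rw [map_mul, hϖL, ← hL₀, hdisc₁]
    refine mul_le_of_le_one_right zero_le ?_
    rw [map_mul]
    exact mul_le_one' (ht1 0) (ht1 1)
  -- `𝔅_h(g₁)` and the bound at the representative
  have hs : ∀ i j k l, Valued.v (ϖ ^ h * (((y * glDiagonal 2 F t * y⁻¹ : GL (Fin 2) F) : Matrix (Fin 2) (Fin 2) F) i j *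
      (((y * glDiagonal 2 F t * y⁻¹)⁻¹ : GL (Fin 2) F) : Matrix (Fin 2) (Fin 2) F) k l)) ≤ 1 := by
    rw [← hg₁']; exact adBall_of_integral_of_inv hint hinv
  have key := hmouth θ Mθ m hM hsupp y t h01 ht1 h L₀ (R (QuotientGroup.mk g)) hs hLdepth
  rw [← hg₁', hmk] at key
  -- `‖ϖ‖ = q⁻¹`, `q^{-2h} ≤ ‖det g₁‖` (so `q^{-h} ≤ a`), `‖disc χ_{g₁}‖ = q^{-L₀}`, `√‖disc χ_{g₁}‖ = |t₀ − t₁|`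
  have hq : normAbs F ϖ = (residueFieldCard F : ℝ≥0)⁻¹ := normAbs_uniformizer_eq_inv hϖ
  have hs0 : (0 : ℝ≥0) < (residueFieldCard F : ℝ≥0)⁻¹ := inv_residueFieldCard_pos
  have hs1 : (residueFieldCard F : ℝ≥0)⁻¹ < 1 := inv_residueFieldCard_lt_one
  have hdet : ((residueFieldCard F : ℝ≥0)⁻¹) ^ (2 * h) ≤ normAbs F ((g₁ : Matrix (Fin 2) (Fin 2) F)).det := by
    have hv := v_pow_pow_two_le_v_det (y := g₁) hinv
    have hn : normAbs F ((ϖ ^ h) ^ 2) ≤ normAbs F ((g₁ : Matrix (Fin 2) (Fin 2) F)).det :=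
      normAbs_le_normAbs_iff.2 ((v_le_iff_valuation_le _ _).1 hv)
    rwa [map_pow, map_pow, hq, ← pow_mul, mul_comm] at hn
  have hdet' : ((residueFieldCard F : ℝ≥0)⁻¹) ^ h ≤ a := by
    have h2h : ((residueFieldCard F : ℝ≥0)⁻¹) ^ (2 * h) = ((((residueFieldCard F : ℝ≥0)⁻¹) ^ h) ^ 2) := by rw [← pow_mul, mul_comm]
    have := NNReal.sqrt_le_sqrt.2 hdet
    rwa [h2h, NNReal.sqrt_sq] at this
  have hDL : ((residueFieldCard F : ℝ≥0)⁻¹) ^ L₀ = normAbs F ((g₁ : Matrix (Fin 2) (Fin 2) F)).charpoly.discr := by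
    have hv : Valued.v ((g₁ : Matrix (Fin 2) (Fin 2) F)).charpoly.discr = Valued.v (ϖ ^ L₀) := by rw [hL₀, hϖL]
    have h1 := normAbs_le_normAbs_iff.2 ((v_le_iff_valuation_le _ _).1 hv.le)
    have h2' := normAbs_le_normAbs_iff.2 ((v_le_iff_valuation_le _ _).1 hv.ge)
    rw [map_pow, hq] at h1 h2'
    exact le_antisymm h2' h1
  have hsqrt : NNReal.sqrt (normAbs F ((g₁ : Matrix (Fin 2) (Fin 2) F)).charpoly.discr) = normAbs F ((t 0 : F) - t 1) := by
    rw [hdisc₁, map_pow, NNReal.sqrt_sq]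
  -- compare exponents and weights
  have hLle : L₀ ≤ L (QuotientGroup.mk g) + 2 * h :=
    le_add_of_pow_eq_of_pow_mul_pow_le hs0 hs1 (hDL.trans hDeq') (hL _ hδ0) hdet'
  refine le_toReal_bound_mono hMθ le_rfl le_rfl (hC m) ?_ ?_ key
  · omega
  · have hr0 : ((residueFieldCard F : ℝ≥0)⁻¹) ^ h ≠ 0 := pow_ne_zero _ hs0.ne'
    have := inv_sqrt_le_of_eq_mul_sq hDeq' hdet' hδ0 hr0
    rwa [inv_pow, inv_inv, hsqrt] at this

include hϖ in
/-- **`hball` PACKAGED IN THE `N = 3` LETTER SHAPE** (the shape consumed token for token by the assembly ★ `K2E3GL3ModUniformizerNonEllEstimatesOfMixed`, here for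
(2N-7) at `N = 2`): binders of ★ `K2E3GL3ModUniformizerNonEllBall.ae_setIntegral_norm_conj_le_weight` :215 verbatim with `Fin 3 ↦ Fin 2` and the `N = 2` normalisation
`δ(mk g) = ‖disc χ_g‖ ∕ ‖det g‖`; conclusion for `μ'`-a.e. `x̄` with non-compact centraliser:
`∫_{Ω (R x̄)} ‖θ(z · x̄ · z⁻¹)‖ dμ'(z) ≤ M_θ · (c · (C m · 3(2(R x̄ + (12 h x̄ + L x̄))+1)² · (‖2‖⁻¹ q^{m+1} · ((q^{3 h x̄}) · δ(x̄)^{-1∕2})))).toReal` — the natural bound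
`ae_setIntegral_norm_conj_le_weight_sharp` weakened by `2(2R′+1) ≤ 3(2R″+1)²`, `q^h ≤ q^{3h}` and `1 ≤ ‖2‖⁻¹ q^{m+1}` (this last step is where `(2 : F) ≠ 0` is used).
[cite: HarishChandra1970, Part VII §2 Theorem 18 p. 69; §3 pp. 72–73] [cite: JacquetLanglands1970, §7] -/
theorem ae_setIntegral_norm_conj_le_weight {E : Type*} [NormedAddCommGroup E] (h2 : (2 : F) ≠ 0)
    (Ω : ℕ → Set (GL (Fin 2) F ⧸ (Subgroup.zpowers (Units.mk0 ϖ hϖ0)).map (Matrix.GeneralLinearGroup.scalar (Fin 2))))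
    (hmem : ∀ (n : ℕ) (z : GL (Fin 2) F),
      (QuotientGroup.mk z : GL (Fin 2) F ⧸ (Subgroup.zpowers (Units.mk0 ϖ hϖ0)).map (Matrix.GeneralLinearGroup.scalar (Fin 2))) ∈ Ω n ↔
        ∀ i j k l, Valued.v (ϖ ^ n * ((z : Matrix (Fin 2) (Fin 2) F) i j * ((z⁻¹ : GL (Fin 2) F) : Matrix (Fin 2) (Fin 2) F) k l)) ≤ 1) :
    ∃ (c : ℝ≥0) (C : ℕ → ℝ≥0∞), (∀ m, C m ≠ ⊤) ∧
      ∀ (θ : GL (Fin 2) F ⧸ (Subgroup.zpowers (Units.mk0 ϖ hϖ0)).map (Matrix.GeneralLinearGroup.scalar (Fin 2)) → E) (Mθ : ℝ) (m : ℕ),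
        (∀ x, ‖θ x‖ ≤ Mθ) → (∀ x, x ∉ Ω m → θ x = 0) →
        ∀ (hgt : GL (Fin 2) F ⧸ (Subgroup.zpowers (Units.mk0 ϖ hϖ0)).map (Matrix.GeneralLinearGroup.scalar (Fin 2)) → ℕ)
          (δ : GL (Fin 2) F ⧸ (Subgroup.zpowers (Units.mk0 ϖ hϖ0)).map (Matrix.GeneralLinearGroup.scalar (Fin 2)) → ℝ≥0)
          (L R : GL (Fin 2) F ⧸ (Subgroup.zpowers (Units.mk0 ϖ hϖ0)).map (Matrix.GeneralLinearGroup.scalar (Fin 2)) → ℕ),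
          (∀ x, x ∈ Ω (hgt x)) →
          (∀ g : GL (Fin 2) F, δ (QuotientGroup.mk g) =
              normAbs F ((g : Matrix (Fin 2) (Fin 2) F)).charpoly.discr / normAbs F ((g : Matrix (Fin 2) (Fin 2) F)).det) →
          (∀ x, δ x ≠ 0 → ((residueFieldCard F : ℝ≥0)⁻¹) ^ (L x) ≤ δ x) →
          ∀ᵐ x ∂μ', ¬ IsCompact ((Subgroup.centralizer {x} :
                Subgroup (GL (Fin 2) F ⧸ (Subgroup.zpowers (Units.mk0 ϖ hϖ0)).map (Matrix.GeneralLinearGroup.scalar (Fin 2)))) :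
              Set (GL (Fin 2) F ⧸ (Subgroup.zpowers (Units.mk0 ϖ hϖ0)).map (Matrix.GeneralLinearGroup.scalar (Fin 2)))) →
            ∫ z in Ω (R x), ‖θ (z * x * z⁻¹)‖ ∂μ' ≤
              Mθ * ((c : ℝ≥0∞) * (C m * ((3 * (2 * (R x + (12 * hgt x + L x)) + 1) ^ 2 : ℕ) : ℝ≥0∞) *
                ((normAbs F (2 : F))⁻¹ * (residueFieldCard F : ℝ≥0) ^ (m + 1) *
                  ((residueFieldCard F : ℝ≥0) ^ (3 * hgt x) * (NNReal.sqrt (δ x))⁻¹) : ℝ≥0))).toReal := by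
  obtain ⟨c, C, hC, hsharp⟩ := ae_setIntegral_norm_conj_le_weight_sharp (E := E) hϖ hϖ0 μ' Ω hmem
  refine ⟨c, C, hC, fun θ Mθ m hM hsupp hgt δ L R hhgt hδ hL => ?_⟩
  have hMθ : 0 ≤ Mθ := (norm_nonneg _).trans (hM 1)
  have hq1 : (1 : ℝ≥0) ≤ (residueFieldCard F : ℝ≥0) := one_lt_residueFieldCard_nnreal.le
  -- `1 ≤ ‖2‖⁻¹ · q^{m+1}`
  have hw1 : (1 : ℝ≥0) ≤ (normAbs F (2 : F))⁻¹ * (residueFieldCard F : ℝ≥0) ^ (m + 1) := by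
    have h2' : normAbs F (2 : F) ≤ 1 := by exact_mod_cast normAbs_natCast_le_one (F := F) 2
    have h20 : normAbs F (2 : F) ≠ 0 := (_root_.map_ne_zero _).2 h2
    exact one_le_mul (one_le_inv_iff₀.2 ⟨pos_iff_ne_zero.2 h20, h2'⟩) (one_le_pow₀ hq1)
  filter_upwards [hsharp θ Mθ m hM hsupp hgt δ L R hhgt hδ hL] with x hx hnc
  refine le_toReal_bound_mono hMθ le_rfl le_rfl (hC m) ?_ ?_ (hx hnc)
  · have hB : 2 * (R x + (4 * hgt x + L x)) + 1 ≤ 2 * (R x + (12 * hgt x + L x)) + 1 := by omega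
    have hsq : 2 * (R x + (12 * hgt x + L x)) + 1 ≤ (2 * (R x + (12 * hgt x + L x)) + 1) ^ 2 := by
      rw [sq]; exact Nat.le_mul_self _
    omega
  · calc (residueFieldCard F : ℝ≥0) ^ (hgt x) * (NNReal.sqrt (δ x))⁻¹
        ≤ (residueFieldCard F : ℝ≥0) ^ (3 * hgt x) * (NNReal.sqrt (δ x))⁻¹ :=
          mul_le_mul_of_nonneg_right (pow_le_pow_right₀ hq1 (by omega)) bot_le
      _ ≤ (normAbs F (2 : F))⁻¹ * (residueFieldCard F : ℝ≥0) ^ (m + 1) * ((residueFieldCard F : ℝ≥0) ^ (3 * hgt x) * (NNReal.sqrt (δ x))⁻¹) :=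
          le_mul_of_one_le_left zero_le hw1

end Summit.HodgeConjecture.HodgeConjecture.Cruxes.H413.K2E3GL2ModUniformizerNonEllBallWeight

end
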